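import Mathlib.Analysis.Calculus.Implicit
import Mathlib.LinearAlgebra.Complex.FiniteDimensional
import Literature.Geometry.Kaehler.NearlyHolomorphicCycleSupport
import HarnessLib

/-!
# Nearly holomorphic cycle supports are topologically locally flat off the bad set

Topic `Literature/Geometry/Kaehler`. Companion to `NearlyHolomorphicCycleSupport.lean`: a nearly
holomorphic regular point of codimension `p` of a set `S` in a complex manifold `M` (charted on the
finite-dimensional complex space `E`, seen as a real `C¹` manifold) is presented by a real `C¹` map
`f : M → ℝ^{2p}` on an open `U ∋ x` with `S ∩ U = U ∩ f⁻¹(0)` and `df_x` onto; by the implicit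
function theorem `S` is then **straightened** near `x` by an open partial homeomorphism
`e : M ⇀ ℝ^{2p} × K` (`K = ker df_x` read in the chart at `x`) with `z ∈ S ↔ (e z).1 = 0` on
`e.source` — the hypothesis shape `hflat` of the tree's tubular-neighbourhood-free engine for
locally flat closed subsets (`Literature.AlgebraicTopology.SingularHomology.surjective_injective_map_compl_of_locallyFlat`,
`…exists_forall_mem_span_localHomologyOfSet_of_locallyFlat`: `H_q(X ∖ S) → H_q(X)` below the
codimension, and the cyclicity of the critical local homology `H_{2p}(X | S)` for `S` connected),
which is how the threshold lemma of route *HolomorphicityRate* (Hodge summit) bounds the classes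
supported on a nearly holomorphic cycle support.

* `IsNearlyHolomorphicRegularPoint.exists_straightening` — the straightening chart at a nearly
  holomorphic regular point (any metric `g`, any defect `t`: only the `C¹` submersion is used);
* `IsNearlyHolomorphicCycleSupport.exists_straightening` — hence at every point of `S ∖ Sg` of a
  nearly holomorphic cycle support `(S, Sg)`.

Proof: in the chart `c = chartAt E x`, `φ = f ∘ c⁻¹ : E → ℝ^{2p}` is `C¹` at `c x` with onto
derivative `mfderiv f x`, hence strictly differentiable, and Mathlib's
`HasStrictFDerivAt.implicitToOpenPartialHomeomorph` gives `e₀ : E ⇀ ℝ^{2p} × ker φ'` with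
`(e₀ y).1 = φ y`; take `e = (c|_U) ≫ e₀`. Theorems only (Lee (2013), Thm. 5.12 / Cor. 5.14:
regular level sets are embedded submanifolds, via the implicit function theorem C.40).

## References

* J. M. Lee, *Introduction to Smooth Manifolds*, 2nd ed. (2013), Thm. 5.12, Cor. 5.14, Thm. C.40.
  [LeeSmoothManifolds2013]
* D. McDuff, D. Salamon, *Introduction to Symplectic Topology*, 3rd ed. (2017), Thm. 7.4.1.
  [McDuffSalamon2017]
-/

noncomputable section

open scoped Manifold ContDiff Topology
open Set Bundle Function

namespace Literature.Geometry.Kaehler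

variable {E : Type} [NormedAddCommGroup E] [NormedSpace ℂ E] [FiniteDimensional ℂ E]
  {M : Type} [TopologicalSpace M] [ChartedSpace E M]

/-- **A nearly holomorphic regular point is a locally flat point**: if `S` is, near `x`, the
regular zero set of a real `C¹` map `f : M → ℝ^{2p}` (`IsNearlyHolomorphicRegularPoint g p t S x`;
the metric `g` and the defect `t` play no role), then there are a finite-dimensional real normed
space `F` of dimension `2p`, a real normed space `K` and an open partial homeomorphism
`e : M ⇀ F × K` with `x ∈ e.source` and `z ∈ S ↔ (e z).1 = 0` for `z ∈ e.source` (the implicit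
function theorem in the chart at `x`). This is the hypothesis shape of the tree's engine for
locally flat closed subsets (`SingularHomology/LocallyFlatComplement`, `…CriticalDegree`).
[cite: LeeSmoothManifolds2013, Thm. 5.12 and Thm. C.40] -/
theorem IsNearlyHolomorphicRegularPoint.exists_straightening
    {g : RiemannianMetric (fun x : M ↦ TangentSpace 𝓘(ℝ, E) x)} {p : ℕ} {t : ℝ} {S : Set M} {x : M}
    (h : IsNearlyHolomorphicRegularPoint g p t S x) :
    ∃ (F : Type) (_ : NormedAddCommGroup F) (_ : NormedSpace ℝ F) (_ : FiniteDimensional ℝ F)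
      (K : Type) (_ : NormedAddCommGroup K) (_ : NormedSpace ℝ K) (e : OpenPartialHomeomorph M (F × K)),
      Module.finrank ℝ F = 2 * p ∧ x ∈ e.source ∧ ∀ z ∈ e.source, z ∈ S ↔ (e z).1 = 0 := by
  obtain ⟨U, hU, hxU, f, hf, hSU, hsurj, -⟩ := h
  haveI : CompleteSpace E := FiniteDimensional.complete ℝ E
  -- the chart at `x` and `f` read in it
  set c : OpenPartialHomeomorph M E := chartAt E x with hc
  have hxc : x ∈ c.source := mem_chart_source E x
  set φ : E → (Fin (2 * p) → ℝ) := f ∘ c.symm with hφ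
  -- `f` is `C¹` at `x`, i.e. `φ` is `C¹` at `c x`
  have hfx : ContMDiffAt 𝓘(ℝ, E) 𝓘(ℝ, Fin (2 * p) → ℝ) 1 f x := (hf x hxU).contMDiffAt (hU.mem_nhds hxU)
  have hφ1 : ContDiffAt ℝ 1 φ (c x) := by
    have h2 := (contMDiffAt_iff.1 hfx).2
    simp only [hc, hφ, mfld_simps] at h2 ⊢
    exact h2.contDiffAt Filter.univ_mem
  have hstrict : HasStrictFDerivAt φ (fderiv ℝ φ (c x)) (c x) := hφ1.hasStrictFDerivAt one_ne_zero
  -- its derivative is `mfderiv f x`, which is onto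
  have hmf : mfderiv 𝓘(ℝ, E) 𝓘(ℝ, Fin (2 * p) → ℝ) f x = fderiv ℝ φ (c x) := by
    rw [(hfx.mdifferentiableAt one_ne_zero).mfderiv]
    simp only [hc, hφ, writtenInExtChartAt, mfld_simps, fderivWithin_univ]
  have hrange : (fderiv ℝ φ (c x)).range = ⊤ := LinearMap.range_eq_top.2 (hmf ▸ hsurj)
  -- the implicit-function straightening of `φ` near `c x`
  set e₀ := hstrict.implicitToOpenPartialHomeomorph φ _ hrange with he₀
  have he₀x : c x ∈ e₀.source := hstrict.mem_implicitToOpenPartialHomeomorph_source hrange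
  have he₀fst : ∀ y, (e₀ y).1 = φ y := fun y ↦ hstrict.implicitToOpenPartialHomeomorph_fst hrange y
  -- transport back to `M`, restricted to `U`
  refine ⟨Fin (2 * p) → ℝ, inferInstance, inferInstance, inferInstance, ↥(fderiv ℝ φ (c x)).ker,
    inferInstance, inferInstance, (c.restrOpen U hU).trans e₀, by simp, ?_, fun z hz ↦ ?_⟩
  · simp only [OpenPartialHomeomorph.trans_source, OpenPartialHomeomorph.restrOpen_source, mem_inter_iff,
      mem_preimage]
    exact ⟨⟨hxc, hxU⟩, by simpa using he₀x⟩
  · simp only [OpenPartialHomeomorph.trans_source, OpenPartialHomeomorph.restrOpen_source, mem_inter_iff,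
      mem_preimage] at hz
    have hzU : z ∈ U := hz.1.2
    have hzc : z ∈ c.source := hz.1.1
    have h1 : ((c.restrOpen U hU).trans e₀ z).1 = f z := by
      rw [OpenPartialHomeomorph.coe_trans, comp_apply, he₀fst]
      change f (c.symm ((c.restrOpen U hU) z)) = f z
      have hcz : (c.restrOpen U hU) z = c z := rfl
      rw [hcz, c.left_inv hzc]
    rw [h1]
    constructor
    · intro hzS
      have : z ∈ U ∩ f ⁻¹' {0} := hSU ▸ ⟨hzS, hzU⟩
      exact this.2
    · intro hfz
      have : z ∈ S ∩ U := hSU.symm ▸ ⟨hzU, hfz⟩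
      exact this.1

/-- **Nearly holomorphic cycle supports are locally flat off the bad set**: at every point of
`S ∖ Sg`, a nearly holomorphic cycle support `(S, Sg)` of codimension `p` is straightened by an open
partial homeomorphism `e : M ⇀ F × K`, `dim_ℝ F = 2p`, `z ∈ S ↔ (e z).1 = 0` on `e.source`
(`IsNearlyHolomorphicRegularPoint.exists_straightening`). [cite: LeeSmoothManifolds2013, Thm. 5.12]
[cite: McDuffSalamon2017, Thm. 7.4.1] -/
theorem IsNearlyHolomorphicCycleSupport.exists_straightening
    {g : RiemannianMetric (fun x : M ↦ TangentSpace 𝓘(ℝ, E) x)} {p : ℕ} {t : ℝ} {S Sg : Set M}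
    (h : IsNearlyHolomorphicCycleSupport g p t S Sg) {x : M} (hx : x ∈ S \ Sg) :
    ∃ (F : Type) (_ : NormedAddCommGroup F) (_ : NormedSpace ℝ F) (_ : FiniteDimensional ℝ F)
      (K : Type) (_ : NormedAddCommGroup K) (_ : NormedSpace ℝ K) (e : OpenPartialHomeomorph M (F × K)),
      Module.finrank ℝ F = 2 * p ∧ x ∈ e.source ∧ ∀ z ∈ e.source, z ∈ S ↔ (e z).1 = 0 :=
  (h.isNearlyHolomorphicRegularPoint hx).exists_straightening

end Literature.Geometry.Kaehler

end
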